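import Summits.QuantumFields.YangMills.Theorems.LuscherReductionTwistedTraceScalingBOFibreBall
import Summits.QuantumFields.YangMills.Theorems.LuscherReductionTwistedTraceScalingBOCapProfile
import Summits.QuantumFields.YangMills.Theorems.LuscherReductionTwistedTraceScalingBTTauBudget
import Summits.QuantumFields.YangMills.Theorems.LuscherReductionTwistedTraceScalingBTCoreFloor
import Summits.QuantumFields.YangMills.Theorems.LuscherReductionTwistedTraceScalingBTFixedBeta
import Summits.QuantumFields.YangMills.Theorems.LuscherReductionTwistedTraceScalingFPWeightCore
import HarnessLib

/-!
# (C5-floor) ★★ AN ABSOLUTE POLYNOMIAL FLOOR FOR THE (B-T) CONSTANT OF THE RECORD PROFILE: `btC ≥ C_L·β^{-K_L}` eventually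
# (lane A of S-BASE, crux `TwistedTraceScaling` stmt-QuantumFields-20203, C4-CORE, the (OD) pen; `pub/ym-fleet/ym-luscher-20007-p1/COARSE-DESIGN.md` §30.6 (c), (C5) tails)

The (C5) tail pieces of the hOD defect (Faddeev–Popov tail, shell/far and gauge-far regions) are bounded ABSOLUTELY, by `e^{4β|E|}·X(β)·‖φ‖₂²` with `X` superpolynomially
small, whereas the hOD currency `(b·σ_BT·λ₀)²·‖φ⊗Ω_c‖²_w` is proportional to `btC²` (`σ_BT = btC·Z⁻¹/γ`).  To compare the two one needs `btC` from below by a POWER of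
`β^{-1}` (times the trivial `K₁(1,1) = e^{2β|E|}` normalisation, `…BTCoreFloor.transferKernel_one_site_one_one_cube`).  The crude floor `…BTCoreFloor.fpBOKernel_one_one_ge`
applied to the whole profile ball (radius `r_f = β^{-1/2}ℓ`) loses `e^{−O(|E|ℓ²)}`; applied to the profile RESTRICTED to the fibre ball of radius `β^{-1}` (where every
Gaussian factor is `≥ e^{-1}`) it loses only a constant, and monotonicity of `fpBOKernel` in the (non-negative) profile transfers the floor:
* §1 ★ `fpBOKernel_mono` — `0 ≤ Ω' ≤ Ω` ⇒ `fpBOKernel Ω' ≤ fpBOKernel Ω` (non-negative weight);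
* §2 `integral_capRestrict_frozenProfile_ball_ge` — `∫ 𝟙_{‖x‖<ε}Ω_c dπ ≥ e^{-2}·π{‖v̂‖ < ε}` for `ε = β^{-1}`, `β ≥ 49` (`q_{β/2,β}(x) ≤ 49β‖x‖²`, `‖P_Γx‖ ≤ ‖x‖`, cap a.e.);
* §3 ★★ `btC_record_poly_floor` — `∃ C > 0, ∃ K, ∀ᶠ β, C·(β^{-1})^K ≤ btC L β (Ω_c β) β^{-1} (5β^{-1/2}ℓ²)` (`K = 3|Site| + 12|E|`; Haar floor of the gauge core
  `…BTHaarFloor`, small-ball floor of `π` `…BOFibreBall.orthoTransverse_real_ball_ge`, `coreWeight ≥ 𝟙_{gaugeCore(ε/3)}` `…BTTauBudget`).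
HONEST FRAMING: bookkeeping for a stub of a child of the CONDITIONAL route R2b1; (C5), the hOD assembly, (B-ST), C4-CORE OPEN; not infinite volume, not a gap, not Clay.
-/

set_option autoImplicit false

noncomputable section

open MeasureTheory Filter Topology Real
open scoped BigOperators
open Literature.MathematicalPhysics.QuantumFieldTheory
open Literature.MathematicalPhysics.QuantumLattice

namespace Summit.QuantumFields.YangMills.Theorems.FemtoTransferGap.TwoLattice.ConstTube

open Summit.QuantumFields.YangMills.Theorems.FemtoTransferGap
open Summit.QuantumFields.YangMills.Theorems.FemtoTransferGap.TwoLattice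
open Summit.QuantumFields.YangMills.Theorems.FemtoTransferGap.TwoLattice.Avg
open Summit.QuantumFields.YangMills.Theorems.FemtoTransferGap.TwoLattice.Stiff
open Summit.QuantumFields.YangMills.Theorems.FemtoTransferGap.TwoLattice.GnChart
open Summit.QuantumFields.YangMills.Theorems.FemtoTransferGap.TwoLattice.Cov

variable {L : ℕ} [NeZero L]

/-! ## §1 ★ Monotonicity of the colour-localised BO kernel in the profile -/

/-- ★ **`fpBOKernel` is monotone in a non-negative profile**: `0 ≤ Ω' ≤ Ω` (bounded measurable) and `W ≥ 0` give `fpBOKernel Ω' ≤ fpBOKernel Ω` at every slow pair.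
[folklore] -/
theorem fpBOKernel_mono (β : ℝ) {Ω Ω' : LinkSpace L → ℝ} (hΩm : Measurable Ω) (hΩ'm : Measurable Ω') {CΩ : ℝ} (hCΩ : ∀ x, |Ω x| ≤ CΩ)
    (hCΩ' : ∀ x, |Ω' x| ≤ CΩ) (hΩ'0 : ∀ x, 0 ≤ Ω' x) (hle : ∀ x, Ω' x ≤ Ω x)
    {W : (Site 3 L → SU2) → ℝ} (hW : Measurable W) {CW : ℝ} (hCW : ∀ g, |W g| ≤ CW) (hW0 : ∀ g, 0 ≤ W g) (u u' : GaugeConfig 3 1 SU2) :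
    fpBOKernel L β Ω' W u u' ≤ fpBOKernel L β Ω W u u' := by
  haveI := isFiniteMeasure_orthoTransverse L
  rw [fpBOKernel_eq_integral_prod β hΩ'm hCΩ' hW hCW, fpBOKernel_eq_integral_prod β hΩm hCΩ hW hCW]
  obtain ⟨B, hB⟩ := abs_fpTriple_le (L := L) β hCΩ hCW u u'
  obtain ⟨B', hB'⟩ := abs_fpTriple_le (L := L) β hCΩ' hCW u u'
  have hint : Integrable (fpTriple L β Ω W u u') ((orthoTransverse L).prod ((orthoTransverse L).prod (gaugeMeasure L))) :=
    integrable_of_measurable_abs_le _ (measurable_fpTriple β hΩm hW u u') hB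
  have hint' : Integrable (fpTriple L β Ω' W u u') ((orthoTransverse L).prod ((orthoTransverse L).prod (gaugeMeasure L))) :=
    integrable_of_measurable_abs_le _ (measurable_fpTriple β hΩ'm hW u u') hB'
  refine integral_mono hint' hint fun p => ?_
  unfold fpTriple
  have hΩ0 : ∀ x, 0 ≤ Ω x := fun x => (hΩ'0 x).trans (hle x)
  have hK := (transferKernel_pos su2Rep β (orthoTube L u p.1) (gaugeTransform p.2.2 (orthoTube L u' p.2.1))).le
  have hWK : 0 ≤ W p.2.2 * transferKernel su2Rep β (orthoTube L u p.1) (gaugeTransform p.2.2 (orthoTube L u' p.2.1)) := mul_nonneg (hW0 _) hK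
  exact mul_le_mul (hle _) (mul_le_mul_of_nonneg_left (hle _) hWK) (mul_nonneg hWK (hΩ'0 _)) (hΩ0 _)

/-! ## §2 The restricted profile: its mass on the fibre ball of radius `β^{-1}` -/

/-- For `β ≥ 49`, `ε = powScale 1 β`: on the fibre ball `‖x‖ < ε` the record profile is `≥ e^{-2}` (cap-balanced `x`), hence
`e^{-2}·π{‖v̂‖ < ε} ≤ ∫ 𝟙_{‖v̂‖<ε}·Ω_c(v̂) dπ`. [folklore] -/
theorem integral_capRestrict_frozenProfile_ball_ge {β : ℝ} (hβ : 49 ≤ β) :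
    Real.exp (-2) * (orthoTransverse L).real {v | ‖linkEmbed L v‖ < powScale 1 β} ≤
      ∫ v, (Metric.ball (0 : LinkSpace L) (powScale 1 β)).indicator (fun _ => (1 : ℝ)) (linkEmbed L v) * (fun x : LinkSpace L => {x : LinkSpace L | linkCurry x ∈ capBalancedSet L}.indicator (fun _ => (1 : ℝ)) x * frozenProfile L (fun β' => stiffGaussExp L (β' / 2) β') (fun β' => min (1 / 40) (powScale (1 / 2) β' * btLog β')) β x) (linkEmbed L v) ∂orthoTransverse L := by
  haveI := isFiniteMeasure_orthoTransverse L
  have hβ1 : 1 ≤ β := by linarith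
  have hβ0 : 0 < β := by linarith
  set ε := powScale 1 β with hεdef
  have hε0 : 0 < ε := powScale_pos _ _
  have hεβ : β * ε = 1 := mul_powScale_one hβ1
  have hεle : ε ≤ 1 / 49 := by
    have : β * ε ≥ 49 * ε := mul_le_mul_of_nonneg_right hβ hε0.le
    linarith
  -- `ε ≤ r_f`
  have hεrf : ε ≤ (min (1 / 40) (powScale (1 / 2) β * btLog β)) := by
    refine le_min (by linarith) ?_
    have h1 : ε ≤ powScale (1 / 2) β := powScale_le_powScale (by norm_num) β
    have h2 : powScale (1 / 2) β * 1 ≤ powScale (1 / 2) β * btLog β := mul_le_mul_of_nonneg_left (one_le_btLog β) (powScale_pos _ _).le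
    linarith
  have hB : MeasurableSet {v : Edge 3 L → Fin 3 → ℝ | ‖linkEmbed L v‖ < ε} := measurableSet_lt ((measurable_linkEmbed L).norm) measurable_const
  set f : (Edge 3 L → Fin 3 → ℝ) → ℝ := fun v => (Metric.ball (0 : LinkSpace L) ε).indicator (fun _ => (1 : ℝ)) (linkEmbed L v) * (fun x : LinkSpace L => {x : LinkSpace L | linkCurry x ∈ capBalancedSet L}.indicator (fun _ => (1 : ℝ)) x * frozenProfile L (fun β' => stiffGaussExp L (β' / 2) β') (fun β' => min (1 / 40) (powScale (1 / 2) β' * btLog β')) β x) (linkEmbed L v) with hf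
  have hqfm : ∀ β', Measurable ((fun β' => stiffGaussExp L (β' / 2) β') β') := fun β' => measurable_stiffGaussExp _ _
  have hqf0 : ∀ β' x, 0 ≤ (fun β' => stiffGaussExp L (β' / 2) β') β' x := fun β' x => stiffGaussExp_nonneg _ _ x
  have hΩGm : Measurable (frozenProfile L (fun β' => stiffGaussExp L (β' / 2) β') (fun β' => min (1 / 40) (powScale (1 / 2) β' * btLog β')) β) := measurable_frozenProfile hqfm _ β
  have hΩG0 : ∀ x, 0 ≤ frozenProfile L (fun β' => stiffGaussExp L (β' / 2) β') (fun β' => min (1 / 40) (powScale (1 / 2) β' * btLog β')) β x := fun x => (frozenProfile_mem_Icc hqf0 _ β x).1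
  have hΩG1 : ∀ x, |frozenProfile L (fun β' => stiffGaussExp L (β' / 2) β') (fun β' => min (1 / 40) (powScale (1 / 2) β' * btLog β')) β x| ≤ 1 := abs_frozenProfile_le hqf0 _ β
  have hΩm := measurable_capRestrict (L := L) hΩGm
  have hΩdat := fun x => capRestrict_mem (L := L) hΩG0 hΩG1 x
  have hfm : Measurable f := by
    rw [hf]
    exact ((measurable_const.indicator Metric.isOpen_ball.measurableSet).comp (measurable_linkEmbed L)).mul (hΩm.comp (measurable_linkEmbed L))
  have hf0 : ∀ v, 0 ≤ f v := fun v => by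
    rw [hf]; dsimp only
    exact mul_nonneg (Set.indicator_nonneg (fun _ _ => zero_le_one) _) (hΩdat _).1
  have hfb : ∀ v, |f v| ≤ 1 := fun v => by
    rw [abs_of_nonneg (hf0 v), hf]; dsimp only
    have h1 : (Metric.ball (0 : LinkSpace L) ε).indicator (fun _ => (1 : ℝ)) (linkEmbed L v) ≤ 1 := by
      by_cases hb : linkEmbed L v ∈ Metric.ball (0 : LinkSpace L) ε
      · rw [Set.indicator_of_mem hb]
      · rw [Set.indicator_of_notMem hb]; exact zero_le_one
    exact mul_le_one₀ h1 (hΩdat _).1 ((le_abs_self _).trans (hΩdat _).2.2)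
  have hfi : Integrable f (orthoTransverse L) := integrable_of_measurable_abs_le _ hfm hfb
  -- cap-balanced a.e.
  have hae : ∀ᵐ v ∂orthoTransverse L, v ∈ capBalancedSet L := by
    rw [ae_iff]
    have : {v : Edge 3 L → Fin 3 → ℝ | ¬v ∈ capBalancedSet L} = (capBalancedSet L)ᶜ := rfl
    rw [this]; exact orthoTransverse_compl_capBalancedSet L
  -- the pointwise floor on the ball, at cap-balanced points
  have hlow : ∀ v ∈ capBalancedSet L, Real.exp (-2) * {v : Edge 3 L → Fin 3 → ℝ | ‖linkEmbed L v‖ < ε}.indicator (fun _ => (1 : ℝ)) v ≤ f v := by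
    intro v hv
    by_cases hvB : v ∈ {v : Edge 3 L → Fin 3 → ℝ | ‖linkEmbed L v‖ < ε}
    · have hvε : ‖linkEmbed L v‖ < ε := hvB
      rw [Set.indicator_of_mem hvB, mul_one, hf]; dsimp only
      have hball : linkEmbed L v ∈ Metric.ball (0 : LinkSpace L) ε := by rw [Metric.mem_ball, dist_zero_right]; exact hvε
      have hcap : linkEmbed L v ∈ {x : LinkSpace L | linkCurry x ∈ capBalancedSet L} := (linkEmbed_mem_capLink_iff v).2 hv
      rw [Set.indicator_of_mem hball, one_mul, Set.indicator_of_mem hcap, one_mul]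
      unfold frozenProfile
      have hcl : linkEmbed L v ∈ Metric.closedBall (0 : LinkSpace L) ((fun β' => min (1 / 40) (powScale (1 / 2) β' * btLog β')) β) := by
        rw [Metric.mem_closedBall, dist_zero_right]; exact hvε.le.trans hεrf
      rw [Set.indicator_of_mem hcl, mul_one, ← Real.exp_add]
      apply Real.exp_le_exp.2
      have hP : ‖(gaugeModes L).starProjection (linkEmbed L v)‖ ≤ ‖linkEmbed L v‖ := Submodule.norm_starProjection_apply_le _ _
      have hx2 : ‖linkEmbed L v‖ ^ 2 ≤ ε ^ 2 := pow_le_pow_left₀ (norm_nonneg _) hvε.le 2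
      have hP2 : ‖(gaugeModes L).starProjection (linkEmbed L v)‖ ^ 2 ≤ ε ^ 2 := (pow_le_pow_left₀ (norm_nonneg _) hP 2).trans hx2
      have hdiv : ‖(gaugeModes L).starProjection (linkEmbed L v)‖ ^ 2 / ε ^ 2 ≤ 1 := by
        rw [div_le_one (by positivity)]; exact hP2
      have hq := stiffGaussExp_le_mul_norm_sq (L := L) (t := β / 2) (by linarith) (b := β) hβ0.le (linkEmbed L v)
      have hq' : stiffGaussExp L (β / 2) β (linkEmbed L v) ≤ 1 := by
        have h1 : (96 * (β / 2) + β) * ‖linkEmbed L v‖ ^ 2 ≤ (96 * (β / 2) + β) * ε ^ 2 := mul_le_mul_of_nonneg_left hx2 (by positivity)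
        have h2 : (96 * (β / 2) + β) * ε ^ 2 = 49 * ε * (β * ε) := by ring
        rw [h2, hεβ, mul_one] at h1
        linarith
      show -2 ≤ -(‖(gaugeModes L).starProjection (linkEmbed L v)‖ ^ 2 / powScale 1 β ^ 2) + -((fun β' => stiffGaussExp L (β' / 2) β') β (linkEmbed L v))
      dsimp only
      rw [← hεdef]
      linarith
    · rw [Set.indicator_of_notMem hvB, mul_zero]; exact hf0 v
  calc Real.exp (-2) * (orthoTransverse L).real {v | ‖linkEmbed L v‖ < ε}
      = ∫ v, Real.exp (-2) * {v : Edge 3 L → Fin 3 → ℝ | ‖linkEmbed L v‖ < ε}.indicator (fun _ => (1 : ℝ)) v ∂orthoTransverse L := by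
        rw [integral_const_mul, integral_indicator hB, setIntegral_const, smul_eq_mul, mul_one, measureReal_def]
    _ ≤ ∫ v, f v ∂orthoTransverse L :=
        integral_mono_ae ((integrable_const _).indicator hB |>.const_mul _) hfi (hae.mono fun v hv => hlow v hv)

/-! ## §3 ★★ The polynomial floor for `btC` -/

/-- ★★ **POLYNOMIAL FLOOR FOR THE (B-T) CONSTANT OF RECORD**: there are `C > 0` and `K` (`= 3|Site| + 12|E|`) with, eventually in `β`,
`C·(powScale 1 β)^K ≤ btC L β (Ω_c β) (powScale 1 β) (5·β^{-1/2}btLog²β)`. [cite: Luscher1983, §3] -/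
theorem btC_record_poly_floor :
    ∃ (C : ℝ) (K : ℕ), 0 < C ∧ ∀ᶠ β : ℝ in atTop, C * powScale 1 β ^ K ≤ btC L β (fun x : LinkSpace L => {x : LinkSpace L | linkCurry x ∈ capBalancedSet L}.indicator (fun _ => (1 : ℝ)) x * frozenProfile L (fun β' => stiffGaussExp L (β' / 2) β') (fun β' => min (1 / 40) (powScale (1 / 2) β' * btLog β')) β x) (powScale 1 β) (5 * (powScale (1 / 2) β * btLog β ^ 2)) := by
  haveI := isFiniteMeasure_orthoTransverse L
  have hE : (0 : ℝ) < Fintype.card (Edge 3 L) := by exact_mod_cast Fintype.card_pos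
  refine ⟨Real.exp (-1) * (1 / 270) ^ Fintype.card (Site 3 L) * (Real.exp (-2) * ((1 / (20 * Fintype.card (Edge 3 L))) ^ 3 / 10) ^ Fintype.card (Edge 3 L)) ^ 2,
    3 * Fintype.card (Site 3 L) + 12 * Fintype.card (Edge 3 L), by positivity, ?_⟩
  -- the exponent loss `X(β) = β|E|(2ε/3 + 2√2ε)² + β((10√|P×3|ε)² + stepActionErr ε 0) → 0`
  have hX : Tendsto (fun β : ℝ => β * ((Fintype.card (Edge 3 L) : ℝ) * (2 * (powScale 1 β / 3) + 2 * Real.sqrt 2 * powScale 1 β) ^ 2) +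
      β * ((10 * Real.sqrt (Fintype.card (Plaquette 3 L × Fin 3)) * powScale 1 β) ^ 2 + stepActionErr (L := L) (powScale 1 β) 0)) atTop (𝓝 0) := by
    -- every summand is `const · β·ε^k` with `k ≥ 2`, and `β·ε = 1` eventually, `ε → 0`
    have hε := tendsto_powScale (σ := 1) one_pos
    have hβε : ∀ᶠ β : ℝ in atTop, β * powScale 1 β = 1 := (eventually_ge_atTop (1 : ℝ)).mono fun β hβ => mul_powScale_one hβ
    have e : ∀ᶠ β : ℝ in atTop, β * ((Fintype.card (Edge 3 L) : ℝ) * (2 * (powScale 1 β / 3) + 2 * Real.sqrt 2 * powScale 1 β) ^ 2) +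
        β * ((10 * Real.sqrt (Fintype.card (Plaquette 3 L × Fin 3)) * powScale 1 β) ^ 2 + stepActionErr (L := L) (powScale 1 β) 0) =
        ((Fintype.card (Edge 3 L) : ℝ) * (2 / 3 + 2 * Real.sqrt 2) ^ 2 + (10 * Real.sqrt (Fintype.card (Plaquette 3 L × Fin 3))) ^ 2) * powScale 1 β +
          (Fintype.card (Plaquette 3 L) : ℝ) * (29376 * powScale 1 β ^ 2 + 700569 * powScale 1 β ^ 3) := by
      filter_upwards [hβε] with β h
      unfold stepActionErr
      rw [Real.sqrt_zero]
      have e1 : β * ((Fintype.card (Edge 3 L) : ℝ) * (2 * (powScale 1 β / 3) + 2 * Real.sqrt 2 * powScale 1 β) ^ 2) =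
          (Fintype.card (Edge 3 L) : ℝ) * (2 / 3 + 2 * Real.sqrt 2) ^ 2 * powScale 1 β * (β * powScale 1 β) := by ring
      have e2 : β * ((10 * Real.sqrt (Fintype.card (Plaquette 3 L × Fin 3)) * powScale 1 β) ^ 2 +
          (Fintype.card (Plaquette 3 L) : ℝ) * (1728 * powScale 1 β ^ 2 * 0 + 29376 * powScale 1 β ^ 3 + 700569 * powScale 1 β ^ 4)) =
          ((10 * Real.sqrt (Fintype.card (Plaquette 3 L × Fin 3))) ^ 2 * powScale 1 β +
            (Fintype.card (Plaquette 3 L) : ℝ) * (29376 * powScale 1 β ^ 2 + 700569 * powScale 1 β ^ 3)) * (β * powScale 1 β) := by ring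
      rw [e1, e2, h, mul_one, mul_one]; ring
    have hlim : Tendsto (fun β : ℝ => ((Fintype.card (Edge 3 L) : ℝ) * (2 / 3 + 2 * Real.sqrt 2) ^ 2 + (10 * Real.sqrt (Fintype.card (Plaquette 3 L × Fin 3))) ^ 2) * powScale 1 β +
          (Fintype.card (Plaquette 3 L) : ℝ) * (29376 * powScale 1 β ^ 2 + 700569 * powScale 1 β ^ 3)) atTop (𝓝 0) := by
      have h := ((hε.const_mul ((Fintype.card (Edge 3 L) : ℝ) * (2 / 3 + 2 * Real.sqrt 2) ^ 2 + (10 * Real.sqrt (Fintype.card (Plaquette 3 L × Fin 3))) ^ 2)).add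
        ((((hε.pow 2).const_mul (29376 : ℝ)).add ((hε.pow 3).const_mul (700569 : ℝ))).const_mul (Fintype.card (Plaquette 3 L) : ℝ)))
      simpa using h
    exact (tendsto_congr' e).mpr hlim
  have hXev : ∀ᶠ β : ℝ in atTop, β * ((Fintype.card (Edge 3 L) : ℝ) * (2 * (powScale 1 β / 3) + 2 * Real.sqrt 2 * powScale 1 β) ^ 2) +
      β * ((10 * Real.sqrt (Fintype.card (Plaquette 3 L × Fin 3)) * powScale 1 β) ^ 2 + stepActionErr (L := L) (powScale 1 β) 0) ≤ 1 :=
    hX.eventually (eventually_le_nhds one_pos)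
  -- `2ε/3 < R₁' = 5β^{-1/2}ℓ²` eventually (indeed always for β ≥ 1, as ε ≤ β^{-1/2} ≤ β^{-1/2}ℓ²)
  filter_upwards [hXev, eventually_ge_atTop (49 : ℝ)] with β hXβ hβ49
  have hβ1 : 1 ≤ β := by linarith
  have hβ0 : 0 < β := by linarith
  set ε := powScale 1 β with hεdef
  have hε0 : 0 < ε := powScale_pos _ _
  have hεβ : β * ε = 1 := mul_powScale_one hβ1
  have hεle : ε ≤ 1 / 49 := by
    have : β * ε ≥ 49 * ε := mul_le_mul_of_nonneg_right hβ49 hε0.le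
    linarith
  have hε1 : ε ≤ 1 := by linarith
  -- profile data
  have hqfm : ∀ β', Measurable ((fun β' => stiffGaussExp L (β' / 2) β') β') := fun β' => measurable_stiffGaussExp _ _
  have hqf0 : ∀ β' x, 0 ≤ (fun β' => stiffGaussExp L (β' / 2) β') β' x := fun β' x => stiffGaussExp_nonneg _ _ x
  have hΩGm : Measurable (frozenProfile L (fun β' => stiffGaussExp L (β' / 2) β') (fun β' => min (1 / 40) (powScale (1 / 2) β' * btLog β')) β) := measurable_frozenProfile hqfm _ β
  have hΩG0 : ∀ x, 0 ≤ frozenProfile L (fun β' => stiffGaussExp L (β' / 2) β') (fun β' => min (1 / 40) (powScale (1 / 2) β' * btLog β')) β x := fun x => (frozenProfile_mem_Icc hqf0 _ β x).1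
  have hΩG1 : ∀ x, |frozenProfile L (fun β' => stiffGaussExp L (β' / 2) β') (fun β' => min (1 / 40) (powScale (1 / 2) β' * btLog β')) β x| ≤ 1 := abs_frozenProfile_le hqf0 _ β
  have hΩm := measurable_capRestrict (L := L) hΩGm
  have hΩdat := fun x => capRestrict_mem (L := L) hΩG0 hΩG1 x
  -- the restricted profile `Ω' = 𝟙_{‖x‖<ε}·Ω_c`
  set Ω' : LinkSpace L → ℝ := fun x => (Metric.ball (0 : LinkSpace L) ε).indicator (fun _ => (1 : ℝ)) x * (fun x : LinkSpace L => {x : LinkSpace L | linkCurry x ∈ capBalancedSet L}.indicator (fun _ => (1 : ℝ)) x * frozenProfile L (fun β' => stiffGaussExp L (β' / 2) β') (fun β' => min (1 / 40) (powScale (1 / 2) β' * btLog β')) β x) x with hΩ'def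
  have hΩ'm : Measurable Ω' := by
    rw [hΩ'def]; exact (measurable_const.indicator Metric.isOpen_ball.measurableSet).mul hΩm
  have hΩ'0 : ∀ x, 0 ≤ Ω' x := fun x => by
    rw [hΩ'def]; exact mul_nonneg (Set.indicator_nonneg (fun _ _ => zero_le_one) _) (hΩdat x).1
  have hΩ'le : ∀ x, Ω' x ≤ (fun x : LinkSpace L => {x : LinkSpace L | linkCurry x ∈ capBalancedSet L}.indicator (fun _ => (1 : ℝ)) x * frozenProfile L (fun β' => stiffGaussExp L (β' / 2) β') (fun β' => min (1 / 40) (powScale (1 / 2) β' * btLog β')) β x) x := fun x => by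
    rw [hΩ'def]; dsimp only
    have h1 : (Metric.ball (0 : LinkSpace L) ε).indicator (fun _ => (1 : ℝ)) x ≤ 1 := by
      by_cases hb : x ∈ Metric.ball (0 : LinkSpace L) ε
      · rw [Set.indicator_of_mem hb]
      · rw [Set.indicator_of_notMem hb]; exact zero_le_one
    have h2 := mul_le_mul_of_nonneg_right h1 (hΩdat x).1
    rwa [one_mul] at h2
  have hΩ'1 : ∀ x, |Ω' x| ≤ 1 := fun x => by
    rw [abs_of_nonneg (hΩ'0 x)]; exact (hΩ'le x).trans ((le_abs_self _).trans (hΩdat x).2.2)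
  have hΩ't : ∀ v : Edge 3 L → Fin 3 → ℝ, Ω' (linkEmbed L v) ≠ 0 → (∀ (e : Edge 3 L) (c : Fin 3), |v e c| ≤ ε) ∧ ‖linkEmbed L v‖ ≤ ε := by
    intro v hv
    have hball : linkEmbed L v ∈ Metric.ball (0 : LinkSpace L) ε := by
      by_contra h
      apply hv; rw [hΩ'def]; dsimp only; rw [Set.indicator_of_notMem h, zero_mul]
    rw [Metric.mem_ball, dist_zero_right] at hball
    refine ⟨fun e c => ?_, hball.le⟩
    have h := abs_apply_le_norm (linkEmbed L v) e c
    rw [linkEmbed_apply] at h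
    exact h.trans hball.le
  -- weight data
  have hWm := measurable_coreWeight (L := L) ε (5 * (powScale (1 / 2) β * btLog β ^ 2))
  have hW01 := fun g => coreWeight_mem_Icc (L := L) ε (5 * (powScale (1 / 2) β * btLog β ^ 2)) g
  have hWb : ∀ g, |coreWeight L ε (5 * (powScale (1 / 2) β * btLog β ^ 2)) g| ≤ 1 := fun g => by rw [abs_of_nonneg (hW01 g).1]; exact (hW01 g).2
  -- gauge core of radius `ε/3` carries full weight
  have hρR : 2 * (ε / 3) < (5 * (powScale (1 / 2) β * btLog β ^ 2)) := by
    have h1 : ε ≤ powScale (1 / 2) β := powScale_le_powScale (by norm_num) β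
    have h2 : powScale (1 / 2) β * 1 ≤ powScale (1 / 2) β * btLog β ^ 2 := mul_le_mul_of_nonneg_left (one_le_pow₀ (one_le_btLog β)) (powScale_pos _ _).le
    linarith
  have hWG : ∀ g ∈ gaugeCore L (ε / 3), 1 ≤ coreWeight L ε (5 * (powScale (1 / 2) β * btLog β ^ 2)) g := fun g hg =>
    coreWeight_ge_one_of_mem_gaugeCore (L := L) hρR (by linarith) (by linarith) hg
  -- the floor for the restricted profile
  have hfloor := fpBOKernel_one_one_ge (L := L) hβ0.le hΩ'm hΩ'1 hΩ'0 hWm hWb (fun g => (hW01 g).1) (ρ := ε / 3) (R := ε) (t := ε) (by positivity)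
    (by linarith) hWG hΩ't
  have hmono := fpBOKernel_mono (L := L) β hΩm hΩ'm (CΩ := 1) (fun x => (hΩdat x).2.2) hΩ'1 hΩ'0 hΩ'le hWm hWb (fun g => (hW01 g).1) 1 1
  -- the ingredients of the floor
  have hHaar : (1 / 270 : ℝ) ^ Fintype.card (Site 3 L) * ε ^ (3 * Fintype.card (Site 3 L)) ≤ (gaugeMeasure L).real (gaugeCore L (ε / 3)) := by
    have h := gaugeMeasure_real_gaugeCore_ge (L := L) (ρ := ε / 3) (by positivity) (by linarith)
    have e : ((ε / 3) ^ 3 / 10) ^ Fintype.card (Site 3 L) = (1 / 270 : ℝ) ^ Fintype.card (Site 3 L) * ε ^ (3 * Fintype.card (Site 3 L)) := by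
      rw [pow_mul, ← mul_pow]; congr 1; ring
    rw [e] at h; exact h
  have hball : ((1 / (20 * Fintype.card (Edge 3 L))) ^ 3 / 10) ^ Fintype.card (Edge 3 L) * ε ^ (6 * Fintype.card (Edge 3 L)) ≤
      (orthoTransverse L).real {v | ‖linkEmbed L v‖ < ε} := by
    have h := orthoTransverse_real_ball_ge (L := L) hε0
    have hmin : min (1 / 50) (ε ^ 2 / (20 * Fintype.card (Edge 3 L))) = ε ^ 2 / (20 * Fintype.card (Edge 3 L)) := by
      refine min_eq_right ?_
      rw [div_le_iff₀ (by positivity)]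
      have h1 : (1 : ℝ) ≤ Fintype.card (Edge 3 L) := by exact_mod_cast Fintype.card_pos
      nlinarith
    rw [hmin] at h
    have e : ((ε ^ 2 / (20 * Fintype.card (Edge 3 L))) ^ 3 / 10) ^ Fintype.card (Edge 3 L) =
        ((1 / (20 * Fintype.card (Edge 3 L))) ^ 3 / 10) ^ Fintype.card (Edge 3 L) * ε ^ (6 * Fintype.card (Edge 3 L)) := by
      rw [pow_mul, ← mul_pow]; congr 1; ring
    rw [e] at h; exact h
  have hmass := integral_capRestrict_frozenProfile_ball_ge (L := L) hβ49
  have hmass' : Real.exp (-2) * (((1 / (20 * Fintype.card (Edge 3 L))) ^ 3 / 10) ^ Fintype.card (Edge 3 L) * ε ^ (6 * Fintype.card (Edge 3 L))) ≤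
      ∫ v, Ω' (linkEmbed L v) ∂orthoTransverse L := by
    rw [hΩ'def]
    exact (mul_le_mul_of_nonneg_left hball (Real.exp_pos _).le).trans hmass
  have hI0 : 0 ≤ ∫ v, Ω' (linkEmbed L v) ∂orthoTransverse L := integral_nonneg fun v => hΩ'0 _
  -- the exponential prefactor: `exp(2β|E| − X) ≥ e^{-1}·K₁(1,1)`
  have hK11 : transferKernel su2Rep ((L : ℝ) ^ 3 * β) (1 : GaugeConfig 3 1 SU2) 1 = Real.exp (β * (2 * (Fintype.card (Edge 3 L) : ℝ))) := transferKernel_one_site_one_one_cube (L := L) β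
  have hK0 : 0 < transferKernel su2Rep ((L : ℝ) ^ 3 * β) (1 : GaugeConfig 3 1 SU2) 1 := transferKernel_pos _ _ _ _
  have hexp : Real.exp (-1) * Real.exp (β * (2 * (Fintype.card (Edge 3 L) : ℝ))) ≤
      Real.exp (β * (2 * (Fintype.card (Edge 3 L) : ℝ)) - β * ((Fintype.card (Edge 3 L) : ℝ) * (2 * (ε / 3) + 2 * Real.sqrt 2 * ε) ^ 2) -
        β * ((10 * Real.sqrt (Fintype.card (Plaquette 3 L × Fin 3)) * ε) ^ 2 + stepActionErr (L := L) ε 0)) := by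
    rw [← Real.exp_add]
    apply Real.exp_le_exp.2
    rw [hεdef] at hXβ ⊢
    linarith
  -- assemble: `C ε^K · K₁ ≤ fpBOKernel Ω' ≤ fpBOKernel Ω_c = btC · K₁`
  have hbtC : btC L β (fun x : LinkSpace L => {x : LinkSpace L | linkCurry x ∈ capBalancedSet L}.indicator (fun _ => (1 : ℝ)) x * frozenProfile L (fun β' => stiffGaussExp L (β' / 2) β') (fun β' => min (1 / 40) (powScale (1 / 2) β' * btLog β')) β x) (powScale 1 β) (5 * (powScale (1 / 2) β * btLog β ^ 2)) * transferKernel su2Rep ((L : ℝ) ^ 3 * β) (1 : GaugeConfig 3 1 SU2) 1 = fpBOKernel L β (fun x : LinkSpace L => {x : LinkSpace L | linkCurry x ∈ capBalancedSet L}.indicator (fun _ => (1 : ℝ)) x * frozenProfile L (fun β' => stiffGaussExp L (β' / 2) β') (fun β' => min (1 / 40) (powScale (1 / 2) β' * btLog β')) β x) (coreWeight L ε (5 * (powScale (1 / 2) β * btLog β ^ 2))) 1 1 := by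
    unfold btC; rw [hεdef]; field_simp
  refine le_of_mul_le_mul_right ?_ hK0
  rw [hbtC]
  refine le_trans ?_ (hfloor.trans hmono)
  have epow : ε ^ (3 * Fintype.card (Site 3 L) + 12 * Fintype.card (Edge 3 L)) = ε ^ (3 * Fintype.card (Site 3 L)) * (ε ^ (6 * Fintype.card (Edge 3 L))) ^ 2 := by
    rw [← pow_mul, ← pow_add]; congr 1; ring
  calc Real.exp (-1) * (1 / 270) ^ Fintype.card (Site 3 L) * (Real.exp (-2) * ((1 / (20 * Fintype.card (Edge 3 L))) ^ 3 / 10) ^ Fintype.card (Edge 3 L)) ^ 2 *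
        ε ^ (3 * Fintype.card (Site 3 L) + 12 * Fintype.card (Edge 3 L)) * transferKernel su2Rep ((L : ℝ) ^ 3 * β) (1 : GaugeConfig 3 1 SU2) 1
      = (Real.exp (-1) * Real.exp (β * (2 * (Fintype.card (Edge 3 L) : ℝ)))) * ((1 / 270 : ℝ) ^ Fintype.card (Site 3 L) * ε ^ (3 * Fintype.card (Site 3 L))) *
          (Real.exp (-2) * (((1 / (20 * Fintype.card (Edge 3 L))) ^ 3 / 10) ^ Fintype.card (Edge 3 L) * ε ^ (6 * Fintype.card (Edge 3 L)))) ^ 2 := by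
        rw [hK11, epow]; ring
    _ ≤ Real.exp (β * (2 * (Fintype.card (Edge 3 L) : ℝ)) - β * ((Fintype.card (Edge 3 L) : ℝ) * (2 * (ε / 3) + 2 * Real.sqrt 2 * ε) ^ 2) -
          β * ((10 * Real.sqrt (Fintype.card (Plaquette 3 L × Fin 3)) * ε) ^ 2 + stepActionErr (L := L) ε 0)) *
          (gaugeMeasure L).real (gaugeCore L (ε / 3)) * (∫ v, Ω' (linkEmbed L v) ∂orthoTransverse L) ^ 2 := by
        gcongr

end Summit.QuantumFields.YangMills.Theorems.FemtoTransferGap.TwoLattice.ConstTube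

end
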